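import Mathlib
import Summits.Ventures.PercRepro2.Defs
import Summits.Ventures.PercRepro2.Independence
import Summits.Ventures.PercRepro2.Harris
import Summits.Ventures.PercRepro2.Graph
import Summits.Ventures.PercRepro2.Events
import Summits.Ventures.PercRepro2.ZCTwoEdge

/-!
# Theorem A on the graph: (ZC) when the root `a₁` has no neighbour outside `{a₃, o}`
(blind cell PercRepro2, mine-a g22; MINE-A.md §69.2)

The graph instance of `zc_two_edge`.  `ends : E → Sym2 V` is the edge-endpoint map, `f₁`, `f₂` are
the two edges at the root `a₁` (`ends f₁ = s(a₁, a₃)`, `ends f₂ = s(a₁, o)`, and no other edge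
contains `a₁`).  With `ω⁻ := ω[f₁ ↦ closed][f₂ ↦ closed]` (the configuration of `G − a₁`):
* `{a₁ ↔ a₃} = {f₁ open} ∪ ({f₂ open} ∩ {a₃ ↔ o in ω⁻})`  (`conn_root_a3_iff`),
* `{a₁ ↔ o} = {f₂ open} ∪ ({f₁ open} ∩ {a₃ ↔ o in ω⁻})`  (`conn_root_o_iff`),
* `C(a₁) = {a₁} ∪ (C⁻(a₃) if f₁ open) ∪ (C⁻(o) if f₂ open)`  (`cluster_root_eq`),
* `{a₃ ↔ o} = {a₃ ↔ o in ω⁻} ∪ {f₁, f₂ open}`  (`conn_a3_o_iff`),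
and the abstract theorem applies with `A' = {a₃ ↔ o in ω⁻}`, `X₁ = {C⁻(a₃) ∪ {a₁} ∈ 𝓔}`,
`X₂ = {C⁻(o) ∪ {a₁} ∈ 𝓔}`, `X₁₂ = {C⁻(a₃) ∪ C⁻(o) ∪ {a₁} ∈ 𝓔}` for any up-set `𝓔` of vertex sets.
The only graph-theoretic input is the closure lemma `mem_of_conn_of_closed`.  One seat.
-/

namespace Summit.Ventures.PercRepro2

section CloseTwo

variable {E : Type*} [DecidableEq E]

/-- `ω⁻` is the same configuration off `f₁`, `f₂`. -/
lemma closeTwo_apply_of_ne {f₁ f₂ : E} (ω : Config E) {e : E} (h1 : e ≠ f₁) (h2 : e ≠ f₂) :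
    Function.update (Function.update ω f₁ false) f₂ false e = ω e := by
    rw [Function.update_of_ne h2, Function.update_of_ne h1]

/-- The first root edge is closed in `ω⁻`. -/
lemma closeTwo_apply_fst {f₁ f₂ : E} (hf : f₁ ≠ f₂) (ω : Config E) :
    Function.update (Function.update ω f₁ false) f₂ false f₁ = false := by
    rw [Function.update_of_ne hf, Function.update_self]

/-- The second root edge is closed in `ω⁻`. -/
lemma closeTwo_apply_snd (f₁ f₂ : E) (ω : Config E) : Function.update (Function.update ω f₁ false) f₂ false f₂ = false := by
  simp

/-- Closing edges is monotone: `ω⁻ ≤ ω`. -/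
lemma closeTwo_le (f₁ f₂ : E) (ω : Config E) : Function.update (Function.update ω f₁ false) f₂ false ≤ ω := by
  intro e
  by_cases h2 : e = f₂
  · subst h2; simp
  · by_cases h1 : e = f₁
    · subst h1; simp [Function.update_of_ne h2]
    · rw [closeTwo_apply_of_ne _ h1 h2]

/-- `ω⁻` ignores forcing `f₁`, `f₂`. -/
lemma closeTwo_update {f₁ f₂ : E} (ω : Config E) (b₁ b₂ : Bool) :
    Function.update (Function.update (Function.update (Function.update ω f₁ b₁) f₂ b₂) f₁ false) f₂
        false = Function.update (Function.update ω f₁ false) f₂ false := by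
  funext e
  by_cases h2 : e = f₂
  · subst h2; simp
  · by_cases h1 : e = f₁
    · subst h1
      simp [Function.update_of_ne h2]
    · rw [closeTwo_apply_of_ne _ h1 h2, closeTwo_apply_of_ne _ h1 h2,
        Function.update_of_ne h2, Function.update_of_ne h1]

/-- `ω⁻` is monotone in `ω`. -/
lemma closeTwo_mono (f₁ f₂ : E) {ω ω' : Config E} (h : ω ≤ ω') :
    Function.update (Function.update ω f₁ false) f₂ false ≤ Function.update (Function.update ω' f₁ false) f₂ false := by
  intro e
  by_cases h2 : e = f₂
  · subst h2; simp
  · by_cases h1 : e = f₁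
    · subst h1; simp [Function.update_of_ne h2]
    · rw [closeTwo_apply_of_ne _ h1 h2, closeTwo_apply_of_ne _ h1 h2]; exact h e

end CloseTwo

section RootTwoEdges

variable {V : Type*} {E : Type*} [DecidableEq E] {ends : E → Sym2 V} {a₁ a₃ o : V} {f₁ f₂ : E}

/-- The root is isolated in `ω⁻`: no cluster of a vertex `x ≠ a₁` contains `a₁`. -/
lemma root_not_mem_cluster_closeTwo (hf : f₁ ≠ f₂)
    (hroot : ∀ e, a₁ ∈ ends e → e = f₁ ∨ e = f₂) (ω : Config E) {x : V} (hx : x ≠ a₁) :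
    a₁ ∉ cluster ends (Function.update (Function.update ω f₁ false) f₂ false) x := by
  intro hmem
  have hS : ∀ v ∈ {v : V | v ≠ a₁}, ∀ y, (openGraph ends (Function.update (Function.update ω f₁ false) f₂ false)).Adj v y →
      y ∈ {v : V | v ≠ a₁} := by
    intro v _ y hvy
    rw [openGraph_adj] at hvy
    obtain ⟨_, e, he, hends⟩ := hvy
    intro hy
    rw [hy] at hends
    have ha : a₁ ∈ ends e := by rw [hends]; exact Sym2.mem_mk_right _ _
    rcases hroot e ha with rfl | rfl
    · rw [closeTwo_apply_fst hf] at he; exact Bool.false_ne_true he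
    · rw [closeTwo_apply_snd] at he; exact Bool.false_ne_true he
  exact (mem_of_conn_of_closed hS hx hmem) rfl

/-- **Closure off the root.**  Let `S = C⁻(x)` be a cluster of `ω⁻` with `x ≠ a₁`.  If no open root
edge of `ω` ends in `S` (`f₁` open → `a₃ ∉ S`; `f₂` open → `o ∉ S`), then `S` absorbs everything
connected to `x` in `ω`. -/
lemma mem_cluster_closeTwo_of_conn (hf : f₁ ≠ f₂) (hends₁ : ends f₁ = s(a₁, a₃))
    (hends₂ : ends f₂ = s(a₁, o)) (hroot : ∀ e, a₁ ∈ ends e → e = f₁ ∨ e = f₂)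
    {ω : Config E} {x : V} (hx : x ≠ a₁)
    (h1 : ω f₁ = true → a₃ ∉ cluster ends (Function.update (Function.update ω f₁ false) f₂ false) x)
    (h2 : ω f₂ = true → o ∉ cluster ends (Function.update (Function.update ω f₁ false) f₂ false) x) {u : V}
    (hc : Conn ends ω x u) : u ∈ cluster ends (Function.update (Function.update ω f₁ false) f₂ false) x := by
  have hroot_not := root_not_mem_cluster_closeTwo hf hroot ω hx
  refine mem_of_conn_of_closed (S := cluster ends (Function.update (Function.update ω f₁ false) f₂ false) x) ?_
    (mem_cluster_self ends _ x) hc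
  intro v hv y hvy
  rw [openGraph_adj] at hvy
  obtain ⟨hne, e, he, hends⟩ := hvy
  by_cases he1 : e = f₁
  · subst he1
    exfalso
    rw [hends₁] at hends
    rcases Sym2.eq_iff.1 hends with ⟨hv1, _⟩ | ⟨_, hv3⟩
    · exact hroot_not (hv1 ▸ hv)
    · exact h1 he (hv3 ▸ hv)
  by_cases he2 : e = f₂
  · subst he2
    exfalso
    rw [hends₂] at hends
    rcases Sym2.eq_iff.1 hends with ⟨hv1, _⟩ | ⟨_, hvo⟩
    · exact hroot_not (hv1 ▸ hv)
    · exact h2 he (hvo ▸ hv)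
  have he' : Function.update (Function.update ω f₁ false) f₂ false e = true := by rw [closeTwo_apply_of_ne _ he1 he2]; exact he
  exact mem_cluster_of_adj hv (openGraph_adj.2 ⟨hne, e, he', hends⟩)

/-- `{a₁ ↔ a₃} = {f₁ open} ∪ ({f₂ open} ∩ {a₃ ↔ o off a₁})`. -/
lemma conn_root_a3_iff (hf : f₁ ≠ f₂) (hends₁ : ends f₁ = s(a₁, a₃)) (hends₂ : ends f₂ = s(a₁, o))
    (hroot : ∀ e, a₁ ∈ ends e → e = f₁ ∨ e = f₂) (h13 : a₁ ≠ a₃) (ω : Config E) :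
    Conn ends ω a₁ a₃ ↔ ω f₁ = true ∨ (ω f₂ = true ∧ Conn ends (Function.update (Function.update ω f₁ false) f₂ false) a₃ o) := by
  constructor
  · intro hc
    by_cases hf1 : ω f₁ = true
    · exact Or.inl hf1
    · right
      have hf1' : ω f₁ = false := by simpa using hf1
      have key : ∀ hno : ¬ Conn ends (Function.update (Function.update ω f₁ false) f₂ false) a₃ o, False := by
        intro hno
        have := mem_cluster_closeTwo_of_conn hf hends₁ hends₂ hroot (Ne.symm h13)
          (fun h => absurd h (by simp [hf1'])) (fun _ => hno) (conn_symm hc)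
        exact root_not_mem_cluster_closeTwo hf hroot ω (Ne.symm h13) this
      by_cases hf2 : ω f₂ = true
      · exact ⟨hf2, by_contra key⟩
      · exfalso
        have hf2' : ω f₂ = false := by simpa using hf2
        have := mem_cluster_closeTwo_of_conn hf hends₁ hends₂ hroot (Ne.symm h13)
          (fun h => absurd h (by simp [hf1'])) (fun h => absurd h (by simp [hf2'])) (conn_symm hc)
        exact root_not_mem_cluster_closeTwo hf hroot ω (Ne.symm h13) this
  · rintro (hf1 | ⟨hf2, hc⟩)
    · exact conn_of_openAdj ⟨f₁, hf1, hends₁⟩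
    · exact conn_trans (conn_of_openAdj ⟨f₂, hf2, hends₂⟩)
        (conn_symm (conn_mono (closeTwo_le f₁ f₂ ω) hc))

/-- `{a₁ ↔ o} = {f₂ open} ∪ ({f₁ open} ∩ {a₃ ↔ o off a₁})`. -/
lemma conn_root_o_iff (hf : f₁ ≠ f₂) (hends₁ : ends f₁ = s(a₁, a₃)) (hends₂ : ends f₂ = s(a₁, o))
    (hroot : ∀ e, a₁ ∈ ends e → e = f₁ ∨ e = f₂) (h1o : a₁ ≠ o) (ω : Config E) :
    Conn ends ω a₁ o ↔ ω f₂ = true ∨ (ω f₁ = true ∧ Conn ends (Function.update (Function.update ω f₁ false) f₂ false) a₃ o) := by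
  constructor
  · intro hc
    by_cases hf2 : ω f₂ = true
    · exact Or.inl hf2
    · right
      have hf2' : ω f₂ = false := by simpa using hf2
      have key : ∀ hno : ¬ Conn ends (Function.update (Function.update ω f₁ false) f₂ false) a₃ o, False := by
        intro hno
        have := mem_cluster_closeTwo_of_conn hf hends₁ hends₂ hroot (Ne.symm h1o)
          (fun _ h => hno (conn_symm h)) (fun h => absurd h (by simp [hf2'])) (conn_symm hc)
        exact root_not_mem_cluster_closeTwo hf hroot ω (Ne.symm h1o) this
      by_cases hf1 : ω f₁ = true
      · exact ⟨hf1, by_contra key⟩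
      · exfalso
        have hf1' : ω f₁ = false := by simpa using hf1
        have := mem_cluster_closeTwo_of_conn hf hends₁ hends₂ hroot (Ne.symm h1o)
          (fun h => absurd h (by simp [hf1'])) (fun h => absurd h (by simp [hf2'])) (conn_symm hc)
        exact root_not_mem_cluster_closeTwo hf hroot ω (Ne.symm h1o) this
  · rintro (hf2 | ⟨hf1, hc⟩)
    · exact conn_of_openAdj ⟨f₂, hf2, hends₂⟩
    · exact conn_trans (conn_of_openAdj ⟨f₁, hf1, hends₁⟩) (conn_mono (closeTwo_le f₁ f₂ ω) hc)

/-- `{a₃ ↔ o} = {a₃ ↔ o off a₁} ∪ {f₁, f₂ open}`. -/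
lemma conn_a3_o_iff (hf : f₁ ≠ f₂) (hends₁ : ends f₁ = s(a₁, a₃)) (hends₂ : ends f₂ = s(a₁, o))
    (hroot : ∀ e, a₁ ∈ ends e → e = f₁ ∨ e = f₂) (h13 : a₁ ≠ a₃) (h1o : a₁ ≠ o) (ω : Config E) :
    Conn ends ω a₃ o ↔ Conn ends (Function.update (Function.update ω f₁ false) f₂ false) a₃ o ∨ (ω f₁ = true ∧ ω f₂ = true) := by
  constructor
  · intro hc
    by_cases hc' : Conn ends (Function.update (Function.update ω f₁ false) f₂ false) a₃ o
    · exact Or.inl hc'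
    · right
      by_contra hboth
      by_cases hf1 : ω f₁ = true
      · have hf2 : ω f₂ = false := by
          rcases Bool.eq_false_or_eq_true (ω f₂) with h | h
          · exact absurd ⟨hf1, h⟩ hboth
          · exact h
        have := mem_cluster_closeTwo_of_conn hf hends₁ hends₂ hroot (Ne.symm h1o)
          (fun _ h => hc' (conn_symm h)) (fun h => absurd h (by simp [hf2])) (conn_symm hc)
        exact hc' (conn_symm this)
      · have hf1' : ω f₁ = false := by simpa using hf1
        have := mem_cluster_closeTwo_of_conn hf hends₁ hends₂ hroot (Ne.symm h13)
          (fun h => absurd h (by simp [hf1'])) (fun _ => hc') hc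
        exact hc' this
  · rintro (hc | ⟨hf1, hf2⟩)
    · exact conn_mono (closeTwo_le f₁ f₂ ω) hc
    · exact conn_trans (conn_symm (conn_of_openAdj ⟨f₁, hf1, hends₁⟩))
        (conn_of_openAdj ⟨f₂, hf2, hends₂⟩)

/-- **The root cluster**: `C(a₁) = {a₁} ∪ (C⁻(a₃) if f₁ open) ∪ (C⁻(o) if f₂ open)`. -/
lemma cluster_root_eq (hf : f₁ ≠ f₂) (hends₁ : ends f₁ = s(a₁, a₃)) (hends₂ : ends f₂ = s(a₁, o))
    (hroot : ∀ e, a₁ ∈ ends e → e = f₁ ∨ e = f₂) (ω : Config E) :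
    cluster ends ω a₁ = {a₁} ∪ {u | ω f₁ = true ∧ u ∈ cluster ends (Function.update (Function.update ω f₁ false) f₂ false) a₃}
      ∪ {u | ω f₂ = true ∧ u ∈ cluster ends (Function.update (Function.update ω f₁ false) f₂ false) o} := by
  ext u
  constructor
  · intro hu
    refine mem_of_conn_of_closed (S := {a₁} ∪ {u | ω f₁ = true ∧ u ∈ cluster ends (Function.update (Function.update ω f₁ false) f₂ false) a₃}
      ∪ {u | ω f₂ = true ∧ u ∈ cluster ends (Function.update (Function.update ω f₁ false) f₂ false) o}) ?_ (by simp) hu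
    intro v hv y hvy
    rw [openGraph_adj] at hvy
    obtain ⟨hne, e, he, hends⟩ := hvy
    by_cases he1 : e = f₁
    · subst he1
      rw [hends₁] at hends
      rcases Sym2.eq_iff.1 hends with ⟨_, hy⟩ | ⟨hy, _⟩
      · subst hy; exact Or.inl (Or.inr ⟨he, mem_cluster_self _ _ _⟩)
      · subst hy; exact Or.inl (Or.inl rfl)
    by_cases he2 : e = f₂
    · subst he2
      rw [hends₂] at hends
      rcases Sym2.eq_iff.1 hends with ⟨_, hy⟩ | ⟨hy, _⟩
      · subst hy; exact Or.inr ⟨he, mem_cluster_self _ _ _⟩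
      · subst hy; exact Or.inl (Or.inl rfl)
    have he' : Function.update (Function.update ω f₁ false) f₂ false e = true := by rw [closeTwo_apply_of_ne _ he1 he2]; exact he
    have hadj : (openGraph ends (Function.update (Function.update ω f₁ false) f₂ false)).Adj v y := openGraph_adj.2 ⟨hne, e, he', hends⟩
    rcases hv with (hv | ⟨h1, hv⟩) | ⟨h2, hv⟩
    · exfalso
      have hv' : v = a₁ := hv
      subst hv'
      have ha : v ∈ ends e := by rw [hends]; exact Sym2.mem_mk_left _ _
      rcases hroot e ha with rfl | rfl
      · exact he1 rfl
      · exact he2 rfl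
    · exact Or.inl (Or.inr ⟨h1, mem_cluster_of_adj hv hadj⟩)
    · exact Or.inr ⟨h2, mem_cluster_of_adj hv hadj⟩
  · rintro ((hu | ⟨h1, hu⟩) | ⟨h2, hu⟩)
    · have hu' : u = a₁ := hu
      subst hu'; exact mem_cluster_self _ _ _
    · exact conn_trans (conn_of_openAdj ⟨f₁, h1, hends₁⟩) (conn_mono (closeTwo_le f₁ f₂ ω) hu)
    · exact conn_trans (conn_of_openAdj ⟨f₂, h2, hends₂⟩) (conn_mono (closeTwo_le f₁ f₂ ω) hu)


end RootTwoEdges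

section GraphTheorem

variable {V : Type*} {E : Type*} [Fintype E] [DecidableEq E] {R : Type*} [CommRing R]
  [LinearOrder R] [IsStrictOrderedRing R]

/-- **Theorem A on the graph (MINE-A.md §69.2).**  Bond percolation on a finite graph `(V, E, ends)`
whose root `a₁` is joined to the rest only by `f₁ = a₁a₃` and `f₂ = a₁o`; `𝓔` an up-set of vertex
sets with `{a₁} ∉ 𝓔`.  With `e = {a₁ ↔ a₃}`, `L = {a₁ ↔ o}`, `U = {C(a₁) ∈ 𝓔}`, `γ = {a₃ ↔ o}`,
`B = eᶜ ∩ Lᶜ ∩ γ = [a₁ | a₃ o]`, `D = eᶜ ∩ Lᶜ ∩ γᶜ = [a₁ | a₃ | o]`: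
  `P(D) · Cov(U, e ∩ L) − P(B) · Cov(U, e ∩ Lᶜ)`
  `≥ (1 − p f₁)² (1 − p f₂)² · p f₂ · (g + p f₁ − g · p f₁) · P(X₁₂ ∩ A'ᶜ) ≥ 0`,
where `A' = {a₃ ↔ o in ω⁻}` (off the root), `g = P(A')`, and
`X₁₂ = {{a₁} ∪ C⁻(a₃) ∪ C⁻(o) ∈ 𝓔}`.  This is (ZC) `P(D) Cov(U, eL) ≥ P(B) Cov(U, e¬L)` on the
class «the root has no neighbour outside `{a₃, o}`», every weight vector, every cluster up-set. -/
theorem zc_two_edge_graph {p : E → R} (hp : IsProbVec p) {ends : E → Sym2 V} {a₁ a₃ o : V}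
    {f₁ f₂ : E} (hf : f₁ ≠ f₂) (hends₁ : ends f₁ = s(a₁, a₃)) (hends₂ : ends f₂ = s(a₁, o))
    (hroot : ∀ e, a₁ ∈ ends e → e = f₁ ∨ e = f₂) (h13 : a₁ ≠ a₃) (h1o : a₁ ≠ o)
    {𝓔 : Set (Set V)} (h𝓔 : IsUpperSet 𝓔) (h𝓔₁ : ({a₁} : Set V) ∉ 𝓔) :
    let e := connEvent ends a₁ a₃
    let L := connEvent ends a₁ o
    let U := clusterInEvent ends a₁ 𝓔
    let γ := connEvent ends a₃ o
    let A' : Set (Config E) := {ω | Conn ends (Function.update (Function.update ω f₁ false) f₂ false) a₃ o}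
    let X₁₂ : Set (Config E) :=
      {ω | {a₁} ∪ cluster ends (Function.update (Function.update ω f₁ false) f₂ false) a₃ ∪ cluster ends (Function.update (Function.update ω f₁ false) f₂ false) o ∈ 𝓔}
    prob p (eᶜ ∩ Lᶜ ∩ γᶜ) * (prob p (U ∩ (e ∩ L)) - prob p U * prob p (e ∩ L))
      - prob p (eᶜ ∩ Lᶜ ∩ γ) * (prob p (U ∩ (e ∩ Lᶜ)) - prob p U * prob p (e ∩ Lᶜ))
      ≥ (1 - p f₁) ^ 2 * (1 - p f₂) ^ 2 * p f₂ * (prob p A' + p f₁ - prob p A' * p f₁)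
        * prob p (X₁₂ ∩ A'ᶜ) := by
  intro e L U γ A' X₁₂
  set X₁ : Set (Config E) := {ω | {a₁} ∪ cluster ends (Function.update (Function.update ω f₁ false) f₂ false) a₃ ∈ 𝓔} with hX₁def
  set X₂ : Set (Config E) := {ω | {a₁} ∪ cluster ends (Function.update (Function.update ω f₁ false) f₂ false) o ∈ 𝓔} with hX₂def
  -- the four graph events in the abstract form
  have he : e = openEdge f₁ ∪ (openEdge f₂ ∩ A') := by
    ext ω
    simp only [e, A', Set.mem_union, Set.mem_inter_iff, Set.mem_setOf_eq, mem_connEvent,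
      mem_openEdge]
    exact conn_root_a3_iff hf hends₁ hends₂ hroot h13 ω
  have hL : L = openEdge f₂ ∪ (openEdge f₁ ∩ A') := by
    ext ω
    simp only [L, A', Set.mem_union, Set.mem_inter_iff, Set.mem_setOf_eq, mem_connEvent,
      mem_openEdge]
    exact conn_root_o_iff hf hends₁ hends₂ hroot h1o ω
  have hγ : γ = A' ∪ (openEdge f₁ ∩ openEdge f₂) := by
    ext ω
    simp only [γ, A', Set.mem_union, Set.mem_inter_iff, Set.mem_setOf_eq, mem_connEvent,
      mem_openEdge]
    exact conn_a3_o_iff hf hends₁ hends₂ hroot h13 h1o ω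
  have hU : U = (openEdge f₁ ∩ closedEdge f₂ ∩ X₁) ∪ (closedEdge f₁ ∩ openEdge f₂ ∩ X₂)
      ∪ (openEdge f₁ ∩ openEdge f₂ ∩ X₁₂) := by
    ext ω
    simp only [U, X₁₂, hX₁def, hX₂def, Set.mem_union, Set.mem_inter_iff, Set.mem_setOf_eq,
      mem_clusterInEvent, mem_openEdge, mem_closedEdge]
    rw [cluster_root_eq hf hends₁ hends₂ hroot ω]
    rcases Bool.eq_false_or_eq_true (ω f₁) with hf1 | hf1 <;>
      rcases Bool.eq_false_or_eq_true (ω f₂) with hf2 | hf2 <;>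
      simp [hf1, hf2, h𝓔₁] <;> rfl
  -- the hypotheses of the abstract theorem
  have hA' : ∀ (ω : Config E) (b₁ b₂ : Bool),
      Function.update (Function.update ω f₁ b₁) f₂ b₂ ∈ A' ↔ ω ∈ A' := by
    intro ω b₁ b₂; simp only [A', Set.mem_setOf_eq, closeTwo_update]
  have hX₁ : ∀ (ω : Config E) (b₁ b₂ : Bool),
      Function.update (Function.update ω f₁ b₁) f₂ b₂ ∈ X₁ ↔ ω ∈ X₁ := by
    intro ω b₁ b₂; simp only [hX₁def, Set.mem_setOf_eq, closeTwo_update]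
  have hX₂ : ∀ (ω : Config E) (b₁ b₂ : Bool),
      Function.update (Function.update ω f₁ b₁) f₂ b₂ ∈ X₂ ↔ ω ∈ X₂ := by
    intro ω b₁ b₂; simp only [hX₂def, Set.mem_setOf_eq, closeTwo_update]
  have hX₁₂ : ∀ (ω : Config E) (b₁ b₂ : Bool),
      Function.update (Function.update ω f₁ b₁) f₂ b₂ ∈ X₁₂ ↔ ω ∈ X₁₂ := by
    intro ω b₁ b₂; simp only [X₁₂, Set.mem_setOf_eq, closeTwo_update]
  have hA'up : IsUpperSet A' := fun ω ω' hle hω =>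
    conn_mono (closeTwo_mono f₁ f₂ hle) hω
  have hX₁₂up : IsUpperSet X₁₂ := by
    intro ω ω' hle hω
    refine h𝓔 ?_ hω
    exact Set.union_subset_union (Set.union_subset_union_right _
      (cluster_mono (closeTwo_mono f₁ f₂ hle) a₃)) (cluster_mono (closeTwo_mono f₁ f₂ hle) o)
  have h1 : X₁ ∩ A' = X₁₂ ∩ A' := by
    ext ω
    simp only [hX₁def, X₁₂, A', Set.mem_inter_iff, Set.mem_setOf_eq]
    constructor
    · rintro ⟨h, hc⟩
      refine ⟨?_, hc⟩
      rw [← cluster_eq_of_conn hc, Set.union_assoc, Set.union_self]; exact h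
    · rintro ⟨h, hc⟩
      refine ⟨?_, hc⟩
      rw [← cluster_eq_of_conn hc, Set.union_assoc, Set.union_self] at h; exact h
  have h2 : X₂ ∩ A' = X₁₂ ∩ A' := by
    ext ω
    simp only [hX₂def, X₁₂, A', Set.mem_inter_iff, Set.mem_setOf_eq]
    constructor
    · rintro ⟨h, hc⟩
      refine ⟨?_, hc⟩
      rw [cluster_eq_of_conn hc, Set.union_assoc, Set.union_self]; exact h
    · rintro ⟨h, hc⟩
      refine ⟨?_, hc⟩
      rw [cluster_eq_of_conn hc, Set.union_assoc, Set.union_self] at h; exact h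
  have h1s : X₁ ⊆ X₁₂ := fun ω hω => h𝓔 Set.subset_union_left hω
  have h2s : X₂ ⊆ X₁₂ := fun ω hω =>
    h𝓔 (Set.union_subset_union_left _ Set.subset_union_left) hω
  rw [he, hL, hU, hγ]
  exact zc_two_edge hp hf hA' hX₁ hX₂ hX₁₂ hA'up hX₁₂up h1 h2 h1s h2s

end GraphTheorem

end Summit.Ventures.PercRepro2
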